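import Literature.NumberTheory.GaloisCohomology.Howard2004.FiniteSingularEvaluation
import Literature.NumberTheory.GaloisRepresentations.ContinuousH1OpenKernelProofs
import Mathlib.GroupTheory.OrderOfElement
import HarnessLib

/-!
# Howard's transverse condition at `λ` is the kernel of restriction to `Γ_{K_λ} ∩ Γ_{K[ℓ]}` for a
# `p`-primary module with trivial local action (proofs file)

Topic `NumberTheory/GaloisCohomology/Howard2004` (vocabulary of `SelmerTriples.lean`: `localRingClassSubgroup`,
`transverseFixer`, `transverseCondition`; cocycle currency of `FiniteSingularEvaluation` / `ContinuousH1OpenKernelProofs`).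
THEOREMS ONLY: no definition, no named fact, no instance, no `sorry`.

B. Howard, *The Heegner point Kolyvagin system*, Compositio Math. 140 (2004) §1.2 (arXiv:1202.6340 p. 6 L84–95):
the transverse condition at `λ ∣ ℓ` is the `L`-transverse one for `L` = «the maximal `p`-subextension of the local
extension `K[ℓ]_λ/K_λ`», i.e. the kernel of restriction to `Γ_L` = `transverseFixer p ℓ jbar λ` (generated by the
`σ ∈ Γ_{K_λ}` a prime-to-`p` power of which fixes `K[ℓ]`).  For a `p`-PRIMARY module `T` with trivial
`Γ_{K_λ}`-action (Howard's `T/I_nT`, `T^{(k)}`, `T̄` at `λ ∈ 𝓛_k(T)`) the passage to the maximal `p`-subextension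
is invisible: a homomorphism `Γ_{K_λ} → T` vanishing on `Γ_{K_λ} ∩ Γ_{K[ℓ]}` vanishes on every `σ` with
`σ^k ∈ Γ_{K[ℓ]}`, `p ∤ k` (`k·φ(σ) = 0` and `p^n·φ(σ) = 0`), hence on `Γ_L`.

* `cocycle_apply_pow` — `z(σ^k) = k • z(σ)` for a cocycle of a trivial module;
* `eq_zero_of_nsmul_eq_zero_of_pow_smul_eq_zero` — `k • x = 0`, `p^n • x = 0`, `p ∤ k` ⟹ `x = 0`;
* **`oneCocycleClass_mem_transverseCondition_iff_forall_localRingClassSubgroup`** — `[z] ∈ H¹_tr(K_λ, T)` iff `z`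
  vanishes on `Γ_{K_λ} ∩ Γ_{K[ℓ]}` (`T` `p`-primary, trivial local action);
* **`transverseCondition_eq_ker_resSubgroup_localRingClassSubgroup`** — `H¹_tr(K_λ, T) = ker (H¹(K_λ, T) →
  H¹(Γ_{K_λ} ∩ Γ_{K[ℓ]}, T))`: Howard's transverse condition IS the `K[ℓ]_λ`-transverse condition of
  Mazur–Rubin/Rubin (Def. 1.1.6 (iv) / Def. 1.9.4) for such `T`.
This is the first step of the complement half of Prop. 1.1.9 (`H¹ = H¹_f ⊕ H¹_tr`, both free of rank two):
`H¹_tr(K_λ, T) = Hom(Gal(K[ℓ]_λ/K_λ), T)`.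

Cell `pub/bsd-print-x9`, G87 = Howard 2004 Thm. 1.6.1 (print leaf `stub_h161` of stmt-BirchSwinnertonDyer-22642);
seat `bsd-line-x9-p1-w3` g14, brick (SPLIT-KER).  BSD is not proved by any of this.

References: [Howard2004HeegnerKolyvagin] §1.2, Prop. 1.1.9 (arXiv:1202.6340 p. 6); [MazurRubinMemoirs2004] Def. 1.1.6 (iv);
[Rubin2011] Def. 1.9.4; [SerreGaloisCohomology1997] I §2.3.
-/

set_option autoImplicit false

noncomputable section

open Function NumberField IsDedekindDomain Field
open scoped NumberField

namespace Literature.NumberTheory.GaloisCohomology.Howard2004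

open Literature.NumberTheory.GaloisRepresentations
open Literature.NumberTheory.GaloisRepresentations.DiscreteGaloisModule
open Literature.NumberTheory.GaloisRepresentations.IsNonarchimedeanLocalField

/-! ## §1 Two small lemmas -/

section Small

variable {F : Type} [Field F] {N : Type} [AddCommGroup N] [TopologicalSpace N] [DiscreteTopology N]

/-- `z(σ^k) = k • z(σ)` for a continuous cocycle of a module with TRIVIAL action (a homomorphism).
[cite: SerreGaloisCohomology1997, I §2.3] -/
theorem cocycle_apply_pow (ρ : DiscreteGaloisModule F N)
    (htriv : ∀ (σ : absoluteGaloisGroup F) (x : N), ρ σ x = x) (z : contOneCocycles ρ.toTopRep)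
    (σ : absoluteGaloisGroup F) (k : ℕ) : z.1 (σ ^ k) = k • z.1 σ := by
  induction k with
  | zero => rw [pow_zero, contOneCocycles.apply_one, zero_smul]
  | succ k ih => rw [pow_succ, cocycle_apply_mul ρ htriv, ih, succ_nsmul]

omit [TopologicalSpace N] [DiscreteTopology N] in
/-- `k • x = 0`, `p^n • x = 0` and `p ∤ k` (i.e. `k` coprime to `p`) force `x = 0` (the additive order of `x`
divides `gcd(k, p^n) = 1`). [cite: SerreGaloisCohomology1997, I §2.3] -/
theorem eq_zero_of_nsmul_eq_zero_of_pow_smul_eq_zero {p k n : ℕ} (hk : Nat.Coprime k p) {x : N}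
    (hkx : k • x = 0) (hpx : p ^ n • x = 0) : x = 0 := by
  have h1 : addOrderOf x ∣ k := addOrderOf_dvd_iff_nsmul_eq_zero.2 hkx
  have h2 : addOrderOf x ∣ p ^ n := addOrderOf_dvd_iff_nsmul_eq_zero.2 hpx
  exact AddMonoid.addOrderOf_eq_one_iff.1 (Nat.eq_one_of_dvd_coprimes (hk.pow_right n) h1 h2)

end Small

/-! ## §2 The transverse condition as the kernel of restriction to `Γ_{K_λ} ∩ Γ_{K[ℓ]}` -/

section Transverse

variable {K : Type} [Field K] [NumberField K] {M : Type} [AddCommGroup M] [TopologicalSpace M]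
  [DiscreteTopology M] (p : ℕ) [Fact p.Prime]

/-- **A cocycle vanishing on `Γ_{K_λ} ∩ Γ_{K[ℓ]}` vanishes on `Γ_L = transverseFixer`** (`T` `p`-primary,
trivial local action): for `σ` with `σ^k ∈ Γ_{K[ℓ]}`, `p ∤ k`, `k • z(σ) = z(σ^k) = 0` and `p^n • z(σ) = 0`, so
`z(σ) = 0`; the zero set of the homomorphism `z` is a subgroup, so it contains the subgroup these `σ` generate.
[cite: Howard2004HeegnerKolyvagin, §1.2 (arXiv:1202.6340 p. 6 L84–95)] -/
theorem forall_transverseFixer_apply_eq_zero_of_forall_localRingClassSubgroup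
    (ρ : DiscreteGaloisModule K M) (ℓ : ℕ) (jbar : AlgebraicClosure K →+* ℂ) (v : HeightOneSpectrum (𝓞 K))
    (htriv : ∀ (g : absoluteGaloisGroup (v.adicCompletion K)) (x : M), GaloisRep.toLocal v ρ g x = x)
    (hp : ∀ x : M, ∃ n : ℕ, p ^ n • x = 0)
    (z : contOneCocycles (DiscreteGaloisModule.toTopRep (GaloisRep.toLocal v ρ)))
    (hz : ∀ g ∈ localRingClassSubgroup ℓ jbar v, z.1 g = 0) :
    ∀ g ∈ transverseFixer p ℓ jbar v, z.1 g = 0 := by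
  -- the zero set of the homomorphism `z` as a subgroup
  let H : Subgroup (absoluteGaloisGroup (v.adicCompletion K)) :=
    { carrier := {g | z.1 g = 0}
      one_mem' := contOneCocycles.apply_one z
      mul_mem' := fun {a b} ha hb => by
        change z.1 (a * b) = 0
        rw [cocycle_apply_mul (GaloisRep.toLocal v ρ) htriv, ha, hb, add_zero]
      inv_mem' := fun {a} ha => by
        change z.1 a⁻¹ = 0
        rw [cocycle_apply_inv (GaloisRep.toLocal v ρ) htriv, ha, neg_zero] }
  have hle : transverseFixer p ℓ jbar v ≤ H := by
    refine (Subgroup.closure_le H).2 ?_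
    rintro σ ⟨k, hk, hσk⟩
    obtain ⟨n, hn⟩ := hp (z.1 σ)
    change z.1 σ = 0
    refine eq_zero_of_nsmul_eq_zero_of_pow_smul_eq_zero hk ?_ hn
    rw [← cocycle_apply_pow (GaloisRep.toLocal v ρ) htriv z σ k]
    exact hz _ hσk
  intro g hg
  exact hle hg

/-- **`[z] ∈ H¹_tr(K_λ, T)` iff `z` vanishes on `Γ_{K_λ} ∩ Γ_{K[ℓ]}`** (`T` `p`-primary, trivial local action).
[cite: Howard2004HeegnerKolyvagin, §1.2 (arXiv:1202.6340 p. 6 L84–95)] [cite: MazurRubinMemoirs2004, Def. 1.1.6 (iv)] -/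
theorem oneCocycleClass_mem_transverseCondition_iff_forall_localRingClassSubgroup
    (ρ : DiscreteGaloisModule K M) (ℓ : ℕ) (jbar : AlgebraicClosure K →+* ℂ) (v : HeightOneSpectrum (𝓞 K))
    (htriv : ∀ (g : absoluteGaloisGroup (v.adicCompletion K)) (x : M), GaloisRep.toLocal v ρ g x = x)
    (hp : ∀ x : M, ∃ n : ℕ, p ^ n • x = 0)
    (z : contOneCocycles (DiscreteGaloisModule.toTopRep (GaloisRep.toLocal v ρ))) :
    oneCocycleClass _ z ∈ transverseCondition p ρ ℓ jbar v ↔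
      ∀ g ∈ localRingClassSubgroup ℓ jbar v, z.1 g = 0 := by
  have key := resSubgroup_oneCocycleClass_eq_zero_iff
    (DiscreteGaloisModule.toTopRep (GaloisRep.toLocal v ρ)) (transverseFixer p ℓ jbar v) z
  refine Iff.trans Iff.rfl (key.trans ?_)
  constructor
  · rintro ⟨w, hw⟩ g hg
    rw [hw g (localRingClassSubgroup_le_transverseFixer p ℓ jbar v hg), ContinuousRep.toTopRep_ρ_apply,
      htriv g w, sub_self]
  · intro h
    exact ⟨0, fun g hg => by
      rw [forall_transverseFixer_apply_eq_zero_of_forall_localRingClassSubgroup p ρ ℓ jbar v htriv hp z h g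
        hg, map_zero, sub_zero]⟩

/-- **`H¹_tr(K_λ, T) = ker (H¹(K_λ, T) → H¹(Γ_{K_λ} ∩ Γ_{K[ℓ]}, T))`**: for a `p`-primary `T` with trivial
`Γ_{K_λ}`-action, Howard's transverse condition (kernel of restriction to `Γ_L`, `L` the maximal `p`-subextension
of `K[ℓ]_λ/K_λ`) is the `K[ℓ]_λ`-transverse condition of Mazur–Rubin (kernel of restriction to
`Γ_{K[ℓ]_λ} = localRingClassSubgroup ℓ jbar λ`).
[cite: Howard2004HeegnerKolyvagin, §1.2 (arXiv:1202.6340 p. 6 L84–95)] [cite: MazurRubinMemoirs2004, Def. 1.1.6 (iv)] -/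
theorem transverseCondition_eq_ker_resSubgroup_localRingClassSubgroup
    (ρ : DiscreteGaloisModule K M) (ℓ : ℕ) (jbar : AlgebraicClosure K →+* ℂ) (v : HeightOneSpectrum (𝓞 K))
    (htriv : ∀ (g : absoluteGaloisGroup (v.adicCompletion K)) (x : M), GaloisRep.toLocal v ρ g x = x)
    (hp : ∀ x : M, ∃ n : ℕ, p ^ n • x = 0) :
    transverseCondition p ρ ℓ jbar v =
      (resSubgroup (DiscreteGaloisModule.toTopRep (GaloisRep.toLocal v ρ)) (localRingClassSubgroup ℓ jbar v)
        1).hom.toLinearMap.toAddMonoidHom.ker := by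
  ext c
  obtain ⟨z, rfl⟩ := oneCocycleClass_surjective _ c
  refine (oneCocycleClass_mem_transverseCondition_iff_forall_localRingClassSubgroup p ρ ℓ jbar v htriv hp
    z).trans ?_
  refine Iff.trans ?_ (Iff.trans (resSubgroup_oneCocycleClass_eq_zero_iff
    (DiscreteGaloisModule.toTopRep (GaloisRep.toLocal v ρ)) (localRingClassSubgroup ℓ jbar v) z).symm Iff.rfl)
  constructor
  · intro h
    exact ⟨0, fun g hg => by rw [h g hg, map_zero, sub_zero]⟩
  · rintro ⟨w, hw⟩ g hg
    rw [hw g hg, ContinuousRep.toTopRep_ρ_apply, htriv g w, sub_self]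

end Transverse

end Literature.NumberTheory.GaloisCohomology.Howard2004

end
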